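import Literature.Probability.Percolation.QuadCrossingContinuityOfBound
import Literature.Probability.Percolation.QuadCrossingContinuityOfLemma51
import Literature.Probability.Percolation.QuadCrossingNullFrontier
import Literature.Probability.Percolation.QuadCrossingSubseqLimits
import Summits.CriticalPhenomena.CardyFormulaZ2.Theorems.CardySelfRefinementLagHandOffQuadContinuityPar2
import HarnessLib

/-!
# Quad continuity for parallelograms: stub `stub_quadContinuity_parallelogram` of line
# `hitting-tournament` for crux `CardySelfRefinement.LagHandOff` (stmt-CriticalPhenomena-10268)

**Schramm–Smirnov's Lemma 5.1 on `ℋ_ℂ` for parallelogram quads** [SchrammSmirnov2011, Lemma 5.1;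
Lemma 6.1] — the parallelogram case of the registered stub `stub_quadContinuity` (which is the
`univ` instance of the tree's named fact `SchrammSmirnov2011_lemma_5_1` and stays blocked for
general quads on the non-tame cases of Lemma 6.1): for every subsequential scaling limit `μ` of
critical bond percolation on `δℤ²` in the Schramm–Smirnov space `ℋ_ℂ` and every quad
`Q p = a + L (chartPt p)` — an affinely parametrised parallelogram, `L` ANY invertible real-linear
map of the plane (all orientations, aspect ratios, shears and side labellings) — the crossing
event `⊞_Q` is a `μ`-continuity set: `μ(∂⊞_Q) = 0` (`stub_quadContinuity_parallelogram`).

Proof.  `continuity_of_parallelogram` is Schramm–Smirnov's discrete estimate (5.1) at such a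
`Q₀`, by the argument of the tree's `Quad.continuity_of_uniform` with the Schoenflies extension
replaced by the AFFINE extension `H z = a + L z` of `Q₀`: the bracket
`Q' = H([-α,α]×[-β,β]) < Q₀ = H([-1,1]²) < Q'' = H([-A,A]×[-B,B])` (`α = 1-t`, `A = 1/α`,
`β = 1+t`, `B = 1/β`; `Quad.strictlyDominated_rectQuad`), the chain
`Q' → [-α,α]×[-B,β] → [-α,α]×[-B,B] → [-A,α]×[-B,B] → Q''` of four one-coordinate moves
(conditions (3), (3), (2), (2) of Lemma 6.1 for the pair or the reversed pair,
`Quad.isPerturbationThree_of_chart` / `Quad.isPerturbationTwo_of_chart`), each bounded by `ε/4`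
through the one-step estimate for PARALLELOGRAM pairs of part 2 (`exists_rho_affine_step`, from
the tree's tame Lemma 6.1 theorems: all chain quads are parallelograms, hence convex, lattice-tame,
with straight free sides and a cut point), `ρ` being fixed before `t` via the uniform lower bound
`d₀ ≥ m(H)` (`Quad.exists_pos_le_sideDist_zero_of_chart`).  The conclusion is then the proved §5
argument `measure_frontier_crossedEvent_eq_zero_of_subseqLimit` (portmanteau).
-/

noncomputable section

open Set Metric Filter MeasureTheory
open scoped unitInterval Topology ENNReal
open Literature.Probability.Percolation Literature.Probability.LatticeModels
open Literature.Probability.Percolation.QuadCrossing Literature.Topology.PlaneTopology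

namespace Summit.CriticalPhenomena.CardyFormulaZ2.Cruxes.LagHandOff.HittingTournament

/-! ### (5.1) for parallelogram quads -/

/-- **Schramm–Smirnov's estimate (5.1) for a parallelogram quad of the plane** (parallelogram
case of [SchrammSmirnov2011, Lemma 5.1, eq. (5.1); Lemma 6.1]): for `Q₀ p = z₀ + L (chartPt p)`
(`L` an invertible real-linear map of `ℂ`) and `ε > 0` there are quads `Q' < Q₀ < Q''` of the
plane and `δ₀ > 0` such that for every mesh `0 < δ < δ₀`, with `P_{1/2}`-probability at most `ε`
the quad `Q'` is crossed inside the open edges of `δℤ²` while `Q''` is not.  The chain argument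
of `Quad.continuity_of_uniform`, run through the affine extension `H z = z₀ + L z`, every step
being a parallelogram pair handled by `exists_rho_affine_step`. -/
theorem continuity_of_parallelogram (z₀ : ℂ) (L : ℂ ≃L[ℝ] ℂ) (Q₀ : Quad (univ : Set ℂ))
    (hQ₀ : ∀ p : I × I, Q₀ p = z₀ + L (Quad.chartPt p)) (ε : ℝ≥0∞) (hε : 0 < ε) :
    ∃ Q' Q'' : Quad (univ : Set ℂ), Quad.StrictlyDominated Q' Q₀ ∧
      Quad.StrictlyDominated Q₀ Q'' ∧ ∃ δ₀ : ℝ, 0 < δ₀ ∧ ∀ δ : ℝ, 0 < δ → δ < δ₀ →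
        bondPercolation (zdGraph 2) half
          {ω | (∃ K, Q'.IsCrossing K ∧ K ⊆ openEdgeUnion δ ω) ∧
            ¬ ∃ K, Q''.IsCrossing K ∧ K ⊆ openEdgeUnion δ ω} ≤ ε := by
  -- a real `ε' > 0` with `4 ε' ≤ ε`
  obtain ⟨ε', hε', hε'ε⟩ : ∃ ε' : ℝ, 0 < ε' ∧ ENNReal.ofReal (4 * ε') ≤ ε := by
    rcases eq_or_ne ε ⊤ with h | h
    · exact ⟨1, one_pos, h ▸ le_top⟩
    · refine ⟨ε.toReal / 4, div_pos (ENNReal.toReal_pos hε.ne' h) (by norm_num), ?_⟩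
      rw [mul_div_cancel₀ _ (by norm_num : (4 : ℝ) ≠ 0), ENNReal.ofReal_toReal h]
  -- the affine extension `H` of `Q₀`
  set H : ℂ ≃ₜ ℂ := L.toHomeomorph.trans (Homeomorph.addLeft z₀) with hHdef
  have hHz : ∀ z, H z = z₀ + L z := fun z => rfl
  have hDu : ∀ (c d : ℝ) (p : I × I), H (Quad.rectMap c d p) ∈ (univ : Set ℂ) :=
    fun _ _ _ => mem_univ _
  -- the uniform lower bound `m` for `d₀` of the larger quads
  obtain ⟨m, hm, hmd⟩ := Quad.exists_pos_le_sideDist_zero_of_chart H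
  -- the perturbation size `ρ` (one-step estimate for parallelogram pairs)
  obtain ⟨ρ, hρ, hstep⟩ := exists_rho_affine_step hHz hm hε'
  -- uniform continuity of `H` on `[-2, 2]²`: moves of size `≤ θ` are `ρ`-short
  obtain ⟨θ, hθ, hHθ⟩ : ∃ θ : ℝ, 0 < θ ∧ ∀ r : ℝ, r ≤ θ →
      ∀ z ∈ (Icc (-2 : ℝ) 2 ×ℂ Icc (-2 : ℝ) 2), ∀ w ∈ (Icc (-2 : ℝ) 2 ×ℂ Icc (-2 : ℝ) 2),
        dist z w ≤ r → dist (H z) (H w) ≤ ρ := by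
    have hCc : IsCompact (Icc (-2 : ℝ) 2 ×ℂ Icc (-2 : ℝ) 2) := isCompact_Icc.reProdIm isCompact_Icc
    obtain ⟨θ, hθ, hHθ⟩ := Metric.uniformContinuousOn_iff.1
      (hCc.uniformContinuousOn_of_continuous H.continuous.continuousOn) ρ hρ
    exact ⟨θ / 2, by linarith, fun r hr z hz w hw hzw => (hHθ z hz w hw (by linarith)).le⟩
  -- the parameter `t`
  obtain ⟨t, ht, htθ, ht2⟩ : ∃ t : ℝ, 0 < t ∧ 4 * t ≤ θ ∧ t ≤ 1 / 2 :=
    ⟨min (1 / 2) (θ / 4), lt_min (by norm_num) (by linarith),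
      by linarith [min_le_right (1 / 2 : ℝ) (θ / 4)], min_le_left _ _⟩
  -- the coordinates `a = 1 - t`, `A = 1/a`, `b = 1 + t`, `B = 1/b` and their bounds
  obtain ⟨a, ha_def⟩ : ∃ a : ℝ, a = 1 - t := ⟨_, rfl⟩
  obtain ⟨b, hb_def⟩ : ∃ b : ℝ, b = 1 + t := ⟨_, rfl⟩
  have hapos : 0 < a := by rw [ha_def]; linarith
  have hbpos : 0 < b := by rw [hb_def]; linarith
  obtain ⟨A, hA_def⟩ : ∃ A : ℝ, A = a⁻¹ := ⟨_, rfl⟩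
  obtain ⟨B, hB_def⟩ : ∃ B : ℝ, B = b⁻¹ := ⟨_, rfl⟩
  have ha : 1 / 2 ≤ a := by rw [ha_def]; linarith
  have ha1 : a < 1 := by rw [ha_def]; linarith
  have hb1 : 1 < b := by rw [hb_def]; linarith
  have hb2 : b ≤ 3 / 2 := by rw [hb_def]; linarith
  have hA1 : 1 < A := by rw [hA_def, inv_eq_one_div, lt_div_iff₀ hapos]; linarith
  have hA2 : A ≤ 2 := by rw [hA_def, inv_eq_one_div, div_le_iff₀ hapos]; linarith
  have hB1 : B < 1 := by rw [hB_def, inv_eq_one_div, div_lt_iff₀ hbpos]; linarith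
  have hB2 : 1 / 2 ≤ B := by rw [hB_def, inv_eq_one_div, le_div_iff₀ hbpos]; linarith
  have hBpos : 0 < B := by linarith
  have hAa : |(-A) - (-a)| ≤ θ := by
    have h1 : A ≤ a + 4 * t := by
      rw [hA_def, inv_eq_one_div, div_le_iff₀ hapos, ha_def]
      nlinarith [mul_nonneg ht.le (by linarith : (0 : ℝ) ≤ 2 - 3 * t)]
    rw [show (-A) - (-a) = -(A - a) by ring, abs_neg, abs_of_nonneg (by linarith)]
    linarith
  have hAa' : |A - a| ≤ θ := by rwa [show (-A) - (-a) = -(A - a) by ring, abs_neg] at hAa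
  have hbB : |b - B| ≤ θ := by
    have h1 : b - 4 * t ≤ B := by
      rw [hB_def, inv_eq_one_div, le_div_iff₀ hbpos, hb_def]
      nlinarith [mul_nonneg ht.le (by linarith : (0 : ℝ) ≤ 3 * t + 2)]
    rw [abs_of_nonneg (by linarith)]
    linarith
  have hbB' : |(-b) - (-B)| ≤ θ := by rwa [show (-b) - (-B) = -(b - B) by ring, abs_neg]
  -- interval memberships (all coordinates lie in `[-2, 2]`)
  have haC : a ∈ Icc (-2 : ℝ) 2 := ⟨by linarith, by linarith⟩
  have hnaC : -a ∈ Icc (-2 : ℝ) 2 := ⟨by linarith, by linarith⟩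
  have hAC : A ∈ Icc (-2 : ℝ) 2 := ⟨by linarith, by linarith⟩
  have hnAC : -A ∈ Icc (-2 : ℝ) 2 := ⟨by linarith, by linarith⟩
  have hbC : b ∈ Icc (-2 : ℝ) 2 := ⟨by linarith, by linarith⟩
  have hnbC : -b ∈ Icc (-2 : ℝ) 2 := ⟨by linarith, by linarith⟩
  have hBC : B ∈ Icc (-2 : ℝ) 2 := ⟨by linarith, by linarith⟩
  have hnBC : -B ∈ Icc (-2 : ℝ) 2 := ⟨by linarith, by linarith⟩
  have haR : a ∈ Icc (1 / 2 : ℝ) 2 := ⟨ha, by linarith⟩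
  have hnaL : -a ∈ Icc (-2 : ℝ) (-1 / 2) := ⟨by linarith, by linarith⟩
  have hAR : A ∈ Icc (1 / 2 : ℝ) 2 := ⟨by linarith, hA2⟩
  have hnAL : -A ∈ Icc (-2 : ℝ) (-1 / 2) := ⟨by linarith, by linarith⟩
  have hane : (-a : ℝ) ≠ a := by linarith
  have hana : (a : ℝ) ≠ -a := by linarith
  have hAne : (-A : ℝ) ≠ A := by linarith
  have hbne : (-b : ℝ) ≠ b := by linarith
  have hbnb : (b : ℝ) ≠ -b := by linarith
  have hBne : (-B : ℝ) ≠ B := by linarith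
  have hBnB : (B : ℝ) ≠ -B := by linarith
  have hnAa : (-A : ℝ) ≠ a := by linarith
  have hanA : (a : ℝ) ≠ -A := by linarith
  have hnBb : (-B : ℝ) ≠ b := by linarith
  have hbnB : (b : ℝ) ≠ -B := by linarith
  have hmB_b : -B ∈ uIcc (-b) b := by
    rw [uIcc_of_le (by linarith)]; exact ⟨by linarith, by linarith⟩
  have hmB_b' : -B ∈ uIcc b (-b) := by rw [uIcc_comm]; exact hmB_b
  have hB_Bb : B ∈ uIcc (-B) b := by
    rw [uIcc_of_le (by linarith)]; exact ⟨by linarith, by linarith⟩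
  have hma_A : -a ∈ uIcc (-A) A := by
    rw [uIcc_of_le (by linarith)]; exact ⟨by linarith, by linarith⟩
  have ha_A : a ∈ uIcc (-A) A := by
    rw [uIcc_of_le (by linarith)]; exact ⟨by linarith, by linarith⟩
  have hma_aA : -a ∈ uIcc a (-A) := by
    rw [uIcc_of_ge (by linarith)]; exact ⟨by linarith, by linarith⟩
  -- the bracket `Q' = Qm < Q₀ < Qp = Q''` (parallelograms read through the affine `H`)
  set Qm : Quad (univ : Set ℂ) := Quad.rectQuad H a b hapos hbpos (hDu a b) with hQm_def
  set Qp : Quad (univ : Set ℂ) := Quad.rectQuad H A B (by linarith) hBpos (hDu A B) with hQp_def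
  have hQ₁ : ∀ (h1 : (0 : ℝ) < 1) (h1' : (0 : ℝ) < 1),
      Quad.rectQuad H 1 1 h1 h1' (hDu 1 1) = Q₀ := fun h1 h1' =>
    Quad.ext fun p => by
      rw [Quad.rectQuad_apply, hQ₀ p, hHz, Quad.rectMap_one_one]
      rfl
  have hlt₁ : Quad.StrictlyDominated Qm Q₀ := by
    have h := Quad.strictlyDominated_rectQuad H hapos ha1 one_pos hb1 (hDu a b) (hDu 1 1)
    rwa [hQ₁] at h
  have hlt₂ : Quad.StrictlyDominated Q₀ Qp := by
    have h := Quad.strictlyDominated_rectQuad H one_pos hA1 hBpos hB1 (hDu 1 1) (hDu A B)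
    rwa [hQ₁] at h
  -- chart presentations of `Q' = Qm` and `Q'' = Qp`
  have hQm' : ∀ p, Qm p = H (Quad.rectChart (-a) a (-b) b p) := fun p => by
    rw [hQm_def, Quad.rectQuad_apply]
    congr 1
    simp only [Quad.rectMap, Quad.rectChart]; push_cast; ring
  have hQp' : ∀ p, Qp p = H (Quad.rectChart (-A) A (-B) B p) := fun p => by
    rw [hQp_def, Quad.rectQuad_apply]
    congr 1
    simp only [Quad.rectMap, Quad.rectChart]; push_cast; ring
  -- the intermediate quads and the reversed presentations
  obtain ⟨Qmr, hQmr⟩ := Quad.exists_quad_of_chart_sub hQm' hane hbne right_mem_uIcc left_mem_uIcc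
    right_mem_uIcc left_mem_uIcc hana hbnb
  obtain ⟨C₁, hC₁⟩ := Quad.exists_quad_of_chart_sub hQm' hane hbne left_mem_uIcc right_mem_uIcc
    hmB_b right_mem_uIcc hane hnBb
  obtain ⟨C₁r, hC₁r⟩ := Quad.exists_quad_of_chart_sub hQm' hane hbne right_mem_uIcc left_mem_uIcc
    right_mem_uIcc hmB_b hana hbnB
  obtain ⟨C₂, hC₂⟩ := Quad.exists_quad_of_chart_sub hQp' hAne hBne hma_A ha_A left_mem_uIcc
    right_mem_uIcc hane hBne
  obtain ⟨C₂r, hC₂r⟩ := Quad.exists_quad_of_chart_sub hQp' hAne hBne ha_A hma_A right_mem_uIcc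
    left_mem_uIcc hana hBnB
  obtain ⟨C₃, hC₃⟩ := Quad.exists_quad_of_chart_sub hQp' hAne hBne left_mem_uIcc ha_A
    left_mem_uIcc right_mem_uIcc hnAa hBne
  obtain ⟨C₃r, hC₃r⟩ := Quad.exists_quad_of_chart_sub hQp' hAne hBne ha_A left_mem_uIcc
    right_mem_uIcc left_mem_uIcc hanA hBnB
  -- the perturbation conditions of the four moves (independent of the mesh)
  have hmove₁ : Qmr.IsPerturbationThree C₁r ρ :=
    Quad.isPerturbationThree_of_chart hQmr hC₁r hana hbnb hbnB hmB_b' haC hnaC hbC hnbC hρ.le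
      (hHθ _ hbB')
  have hmove₂ : C₁.IsPerturbationThree C₂ ρ :=
    Quad.isPerturbationThree_of_chart hC₁ hC₂ hane hnBb hBne hB_Bb hnaC haC hnBC hbC hρ.le
      (hHθ _ hbB)
  have hmove₃ : C₃r.IsPerturbationTwo C₂r ρ :=
    Quad.isPerturbationTwo_of_chart hC₃r hC₂r hanA hana hBnB hma_aA haC hnAC hBC hnBC hρ.le
      (hHθ _ hAa)
  have hmove₄ : Qp.IsPerturbationTwo C₃ ρ :=
    Quad.isPerturbationTwo_of_chart hQp' hC₃ hAne hnAa hBne ha_A hnAC hAC hnBC hBC hρ.le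
      (hHθ _ hAa')
  refine ⟨Qm, Qp, hlt₁, hlt₂, ρ, hρ, fun δ hδ hδρ => ?_⟩
  -- the raw crossing events at mesh `δ`; reversal does not change them
  have hRrev : ∀ {P P' : Quad (univ : Set ℂ)} {u₀ u₁ v₀ v₁ : ℝ},
      (∀ p, P p = H (Quad.rectChart u₀ u₁ v₀ v₁ p)) →
      (∀ p, P' p = H (Quad.rectChart u₁ u₀ v₁ v₀ p)) → u₀ ≠ u₁ → v₀ ≠ v₁ →
      {ω | ∃ K, P'.IsCrossing K ∧ K ⊆ openEdgeUnion δ ω} =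
        {ω | ∃ K, P.IsCrossing K ∧ K ⊆ openEdgeUnion δ ω} :=
    fun hP hP' hu hv => by
      ext ω
      simp only [mem_setOf_eq, Quad.isCrossing_iff_of_chart_rev hP hP' hu hv]
  -- one step: the estimate for a parallelogram pair at mesh `δ` (law at `η = δ/√2 < ρ`)
  have h2 : (1 : ℝ) < Real.sqrt 2 := Real.one_lt_sqrt_two
  have hη : 0 < δ / Real.sqrt 2 := div_pos hδ (by linarith)
  have hηρ : δ / Real.sqrt 2 < ρ := (div_lt_self hδ h2).trans hδρ
  have hst : ∀ {P P' : Quad (univ : Set ℂ)} {u₀ u₁ v₀ v₁ u₀' u₁' v₀' v₁' : ℝ},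
      (∀ p, P p = H (Quad.rectChart u₀ u₁ v₀ v₁ p)) →
      (∀ p, P' p = H (Quad.rectChart u₀' u₁' v₀' v₁' p)) →
      u₀ ≠ u₁ → v₀ ≠ v₁ → u₀' ≠ u₁' → v₀' ≠ v₁' →
      v₀ ∈ Icc (-2 : ℝ) 2 → v₁ ∈ Icc (-2 : ℝ) 2 →
      (u₀ ∈ Icc (-2 : ℝ) (-1/2) ∧ u₁ ∈ Icc (1/2 : ℝ) 2 ∨
        u₁ ∈ Icc (-2 : ℝ) (-1/2) ∧ u₀ ∈ Icc (1/2 : ℝ) 2) →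
      (P.IsPerturbationTwo P' ρ ∨ P.IsPerturbationThree P' ρ) →
      (bondPercolation (zdGraph 2) half).real
        (symmDiff {ω | ∃ K, P.IsCrossing K ∧ K ⊆ openEdgeUnion δ ω}
          {ω | ∃ K, P'.IsCrossing K ∧ K ⊆ openEdgeUnion δ ω}) ≤ ε' := by
    intro P P' u₀ u₁ v₀ v₁ u₀' u₁' v₀' v₁' hP hP' hu hv hu' hv' hv₀ hv₁ huu hcond
    have hmP : m ≤ P.sideDist 0 := hmd P u₀ u₁ v₀ v₁ hP hv hv₀ hv₁ huu
    rw [measureReal_symmDiff_setOf_exists_isCrossing isOpen_univ hδ]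
    exact hstep _ P P' u₀ u₁ v₀ v₁ u₀' u₁' v₀' v₁' hP hP' hu hv hu' hv' hmP hcond _ hη hηρ
  -- the four steps
  have h₁ : (bondPercolation (zdGraph 2) half).real
      (symmDiff {ω | ∃ K, Qm.IsCrossing K ∧ K ⊆ openEdgeUnion δ ω}
        {ω | ∃ K, C₁.IsCrossing K ∧ K ⊆ openEdgeUnion δ ω}) ≤ ε' := by
    rw [← hRrev hQm' hQmr hane hbne, ← hRrev hC₁ hC₁r hane hnBb]
    exact hst hQmr hC₁r hana hbnb hana hbnB hbC hnbC (Or.inr ⟨hnaL, haR⟩) (Or.inr hmove₁)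
  have h₂ : (bondPercolation (zdGraph 2) half).real
      (symmDiff {ω | ∃ K, C₁.IsCrossing K ∧ K ⊆ openEdgeUnion δ ω}
        {ω | ∃ K, C₂.IsCrossing K ∧ K ⊆ openEdgeUnion δ ω}) ≤ ε' :=
    hst hC₁ hC₂ hane hnBb hane hBne hnBC hbC (Or.inl ⟨hnaL, haR⟩) (Or.inr hmove₂)
  have h₃ : (bondPercolation (zdGraph 2) half).real
      (symmDiff {ω | ∃ K, C₂.IsCrossing K ∧ K ⊆ openEdgeUnion δ ω}
        {ω | ∃ K, C₃.IsCrossing K ∧ K ⊆ openEdgeUnion δ ω}) ≤ ε' := by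
    rw [← hRrev hC₂ hC₂r hane hBne, ← hRrev hC₃ hC₃r hnAa hBne, symmDiff_comm]
    exact hst hC₃r hC₂r hanA hBnB hana hBnB hBC hnBC (Or.inr ⟨hnAL, haR⟩) (Or.inl hmove₃)
  have h₄ : (bondPercolation (zdGraph 2) half).real
      (symmDiff {ω | ∃ K, C₃.IsCrossing K ∧ K ⊆ openEdgeUnion δ ω}
        {ω | ∃ K, Qp.IsCrossing K ∧ K ⊆ openEdgeUnion δ ω}) ≤ ε' := by
    rw [symmDiff_comm]
    exact hst hQp' hC₃ hAne hBne hnAa hBne hnBC hBC (Or.inl ⟨hnAL, hAR⟩) (Or.inl hmove₄)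
  -- the chain inclusion and the sum
  have hreal : (bondPercolation (zdGraph 2) half).real
      {ω | (∃ K, Qm.IsCrossing K ∧ K ⊆ openEdgeUnion δ ω) ∧
        ¬ ∃ K, Qp.IsCrossing K ∧ K ⊆ openEdgeUnion δ ω} ≤ 4 * ε' := by
    have := measureReal_diff_le_chain (bondPercolation (zdGraph 2) half)
      {ω | ∃ K, Qm.IsCrossing K ∧ K ⊆ openEdgeUnion δ ω}
      {ω | ∃ K, C₁.IsCrossing K ∧ K ⊆ openEdgeUnion δ ω}
      {ω | ∃ K, C₂.IsCrossing K ∧ K ⊆ openEdgeUnion δ ω}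
      {ω | ∃ K, C₃.IsCrossing K ∧ K ⊆ openEdgeUnion δ ω}
      {ω | ∃ K, Qp.IsCrossing K ∧ K ⊆ openEdgeUnion δ ω}
    have hset : {ω | (∃ K, Qm.IsCrossing K ∧ K ⊆ openEdgeUnion δ ω) ∧
        ¬ ∃ K, Qp.IsCrossing K ∧ K ⊆ openEdgeUnion δ ω} =
        {ω | ∃ K, Qm.IsCrossing K ∧ K ⊆ openEdgeUnion δ ω} \
          {ω | ∃ K, Qp.IsCrossing K ∧ K ⊆ openEdgeUnion δ ω} := Set.ext fun _ => Iff.rfl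
    rw [hset]
    linarith
  calc bondPercolation (zdGraph 2) half
        {ω | (∃ K, Qm.IsCrossing K ∧ K ⊆ openEdgeUnion δ ω) ∧
          ¬ ∃ K, Qp.IsCrossing K ∧ K ⊆ openEdgeUnion δ ω}
      = ENNReal.ofReal ((bondPercolation (zdGraph 2) half).real
          {ω | (∃ K, Qm.IsCrossing K ∧ K ⊆ openEdgeUnion δ ω) ∧
            ¬ ∃ K, Qp.IsCrossing K ∧ K ⊆ openEdgeUnion δ ω}) := (ofReal_measureReal).symm
    _ ≤ ENNReal.ofReal (4 * ε') := ENNReal.ofReal_le_ofReal hreal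
    _ ≤ ε := hε'ε

/-! ### The stub: Lemma 5.1 on `ℋ_ℂ` for parallelogram quads -/

/-- **Stub `stub_quadContinuity_parallelogram` (line `hitting-tournament`, crux `LagHandOff`):
Schramm–Smirnov's Lemma 5.1 on `ℋ_ℂ`, parallelogram case** [SchrammSmirnov2011, Lemma 5.1;
Lemma 6.1].  For every subsequential scaling limit `μ ∈ subseqQuadLimits univ` of critical bond
percolation on `δℤ²` in the Schramm–Smirnov space `ℋ_ℂ`, every `a ∈ ℂ`, every invertible
continuous real-linear map `L` of `ℂ` and every quad `Q` of the plane with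
`Q p = a + L (chartPt p)` (`chartPt p = (2x-1) + (2y-1)i`: `Q` is the affinely parametrised
parallelogram `a + L([-1,1]²)`, covering all parallelograms in every orientation, aspect ratio,
shear and side labelling, in particular all rectangles), the boundary of the crossing event `⊞_Q`
is `μ`-null: `μ(∂⊞_Q) = 0`.  This is the sub-goal of the registered stub `stub_quadContinuity`
(= the `univ` instance of the named fact `SchrammSmirnov2011_lemma_5_1`, all quads) that the
tree's tame Lemma 6.1 theorems discharge; proof: `continuity_of_parallelogram` ((5.1) at `Q`)
fed into `measure_frontier_crossedEvent_eq_zero_of_subseqLimit` (the §5 portmanteau argument). -/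
theorem stub_quadContinuity_parallelogram : ∀ μ ∈ subseqQuadLimits (univ : Set ℂ), ∀ (a : ℂ) (L : ℂ ≃L[ℝ] ℂ) (Q : Quad (univ : Set ℂ)), (∀ p : unitInterval × unitInterval, Q p = a + L (Quad.chartPt p)) → (μ : Measure (QuadConfig (univ : Set ℂ))) (frontier (QuadConfig.crossedEvent Q)) = 0 :=
  fun _ hμ a L Q hQ => measure_frontier_crossedEvent_eq_zero_of_subseqLimit isOpen_univ
    univ_nonempty hμ Q (continuity_of_parallelogram a L Q hQ)

end Summit.CriticalPhenomena.CardyFormulaZ2.Cruxes.LagHandOff.HittingTournament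

end
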